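import Summits.ValiantsHypothesis.ValiantsHypothesis.Theses.PrincipalMinorColouring

/-!
# Glue for `RankTwoImpossible` (item stmt-ValiantsHypothesis-3782, route PrincipalMinorColouring)

Two pure-logic reductions of the rank-two rung of the principal-minor ladder:

* `rankTwoImpossible_of_boundedRankImpossible` — it is the `r = 2` instance of the crux
  `BoundedRankImpossible`;
* `rankTwoImpossible_of_heredity` — by the heredity/conditioning support `Heredity` (freeze row and
  column `n + 1` at the pattern of `J`), a single base size `n₀` at which `per_{n₀}(x + J)` has no
  principal-minor representation with colour classes of size `≤ 2` propagates to every `n ≥ n₀`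
  (IL17 Lemma 6.2 in the normal form).  So the item is `Heredity` plus ONE finite (certified)
  infeasibility computation; `n₀ ≥ 4` since `per_3` is rank-two expressible (Grenet's `7 × 7`).

No analysis here; the finite base case is the open part.
-/

namespace Summit.ValiantsHypothesis.ValiantsHypothesis.Theorems

-- justification: `Summit.<Summit>.<Problem>` repeats the name for single-problem summits (CONVENTIONS §1).
set_option linter.dupNamespace false

open Summit.ValiantsHypothesis.ValiantsHypothesis.Theses.PrincipalMinorColouring

/-- `RankTwoImpossible` is the `r = 2` instance of `BoundedRankImpossible`. -/
theorem rankTwoImpossible_of_boundedRankImpossible (h : BoundedRankImpossible) :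
    RankTwoImpossible := by
  obtain ⟨n₀, hn₀⟩ := h 2
  exact ⟨n₀, fun n hn R K κ hκ => hn₀ n hn R K κ hκ⟩

/-- Heredity step at `r = 2`: if `per_n(x + J)` has no principal-minor representation with colour
classes of size `≤ 2`, then neither has `per_{n+1}(x + J)` (contrapositive of `Heredity` at `r = 2`). -/
theorem noRankTwoRepr_succ (hH : Heredity) {n : ℕ}
    (h : ∀ (R : ℕ) (K : Matrix (Fin R) (Fin R) ℂ) (κ : Fin R → Fin n × Fin n),
      (∀ e, (Finset.univ.filter (fun i => κ i = e)).card ≤ 2) →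
        MvPolynomial.aeval (fun e => MvPolynomial.X e + 1)
            (Literature.Computability.AlgebraicComplexity.perPoly (Fin n) ℂ) ≠
          MvPolynomial.C (n.factorial : ℂ) *
            (1 + Matrix.diagonal (fun i => MvPolynomial.X (κ i)) *
              K.map (fun a : ℂ => (MvPolynomial.C a : MvPolynomial (Fin n × Fin n) ℂ))).det) :
    ∀ (R : ℕ) (K : Matrix (Fin R) (Fin R) ℂ) (κ : Fin R → Fin (n + 1) × Fin (n + 1)),
      (∀ e, (Finset.univ.filter (fun i => κ i = e)).card ≤ 2) →
        MvPolynomial.aeval (fun e => MvPolynomial.X e + 1)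
            (Literature.Computability.AlgebraicComplexity.perPoly (Fin (n + 1)) ℂ) ≠
          MvPolynomial.C ((n + 1).factorial : ℂ) *
            (1 + Matrix.diagonal (fun i => MvPolynomial.X (κ i)) *
              K.map (fun a : ℂ =>
                (MvPolynomial.C a : MvPolynomial (Fin (n + 1) × Fin (n + 1)) ℂ))).det := by
  intro R K κ hκ heq
  obtain ⟨R', -, K', κ', hκ', heq'⟩ := hH n 2 R K κ hκ heq
  exact h R' K' κ' hκ' heq'

/-- Heredity reduction: `Heredity` and one base size `n₀` at which `per_{n₀}(x + J)` has no
principal-minor representation with colour classes of size `≤ 2` give `RankTwoImpossible`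
(with that `n₀`), by induction on `n ≥ n₀`. -/
theorem rankTwoImpossible_of_heredity (hH : Heredity) {n₀ : ℕ}
    (h₀ : ∀ (R : ℕ) (K : Matrix (Fin R) (Fin R) ℂ) (κ : Fin R → Fin n₀ × Fin n₀),
      (∀ e, (Finset.univ.filter (fun i => κ i = e)).card ≤ 2) →
        MvPolynomial.aeval (fun e => MvPolynomial.X e + 1)
            (Literature.Computability.AlgebraicComplexity.perPoly (Fin n₀) ℂ) ≠
          MvPolynomial.C (n₀.factorial : ℂ) *
            (1 + Matrix.diagonal (fun i => MvPolynomial.X (κ i)) *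
              K.map (fun a : ℂ => (MvPolynomial.C a : MvPolynomial (Fin n₀ × Fin n₀) ℂ))).det) :
    RankTwoImpossible := by
  refine ⟨n₀, fun n hn => ?_⟩
  induction n, hn using Nat.le_induction with
  | base => exact h₀
  | succ m _ ih => exact noRankTwoRepr_succ hH ih

end Summit.ValiantsHypothesis.ValiantsHypothesis.Theorems
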